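import Summits.BirchSwinnertonDyer.BirchSwinnertonDyer.Theorems.KolyvaginDepthDoorKolyvaginDepthSupplyDoorOfDatum
import Summits.BirchSwinnertonDyer.BirchSwinnertonDyer.Theorems.KolyvaginDepthDoorKolyvaginDepthSupplyDoorNoTwistTwistSelmer
import HarnessLib

/-!
# Route `KolyvaginDepthDoor`, crux `KolyvaginDepthSupply` (stmt-BirchSwinnertonDyer-21765) —
# the descent data OF A DATUM and the twist Selmer bound `#Sel_p(E^{(d_K)}/ℚ) ≤ p^{ν}`, system-free

Helper file (`--supports stmt-BirchSwinnertonDyer-21765 --as helper`); it closes nothing and BSD is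
not proved by it.

Sequel of `…KolyvaginDepthSupplyDoorOfDatum`: the same construction (extend the datum `d₁` to a
compatible system on all square-free inert levels by `exists_kolyvaginHeegnerSystem_extending`, feed its
classes to `exists_hypothesesDepth_of_classes`, discharge the Euler-system hypotheses by the five named
McCallum/Gross facts) packaged as an EXISTENCE statement for Kolyvagin's minimal-depth descent data,
so that every `HypothesesDepth`-reader of the route applies to a datum:

* `exists_hypothesesDepth_of_datum` — five named facts + ONE datum `d₁` at a square-free product `n₁`
  of Kolyvagin primes ⟹ a `KolyvaginDescent.HypothesesDepth` on `H¹(K, E[p^1])` with `Sel = Sel(E/K)`,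
  `τ = conjAct`, Zhang's Kolyvagin primes, and `c n₁ = d₁.kolyvaginClass hp 1`;
* `natCard_selmerGroup_twist_le_of_kolyvaginClass_ne_zero_of_datum` — the other eigenspace: with
  `d₁.kolyvaginClass hp 1 ≠ 0` and `ν + 1 ≤ rank E(ℚ)`, `Sel^(p)(E^{(d_K)}/ℚ)` is finite of order
  `≤ p^{ν}` and `p^{rank E^{(d_K)}} · #E^{(d_K)}(ℚ)[p] · #Ш(E^{(d_K)}/ℚ)[p] ≤ p^{ν}`
  (g6's `natCard_selmerGroup_twist_le_of_hypothesesDepth`, Literature `SelmerTorsionTwistRestriction`).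

CONDITIONAL on the five named facts; per-curve; BSD is not proved by it.

References: [GrossLMS1991] §§3–5, §10; [McCallumLMS1991] §§2–5; [Kolyvagin1991MathAnn] Thm. 2.3;
[WZhang2014] Notations (xii).
-/

set_option linter.dupNamespace false

noncomputable section

open scoped Classical

namespace Summit.BirchSwinnertonDyer.BirchSwinnertonDyer.Theorems.KolyvaginDepthDoor

open Literature.NumberTheory.EllipticCurves Literature.NumberTheory.EllipticCurves.ModularForms
  Literature.NumberTheory.EllipticCurves.KolyvaginDescent
  Literature.NumberTheory.EllipticCurves.McCallum1991 WeierstrassCurve NumberField IsDedekindDomain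

section Datum

variable {W : WeierstrassCurve ℚ} [W.IsElliptic] [W.IsGloballyMinimal] [NeZero (W.conductorNorm ℤ)]
  {K : Type} [Field K] [NumberField K]
  {Dt : ModularParametrizationData W (W.conductorNorm ℤ)} {β : ℤ} {ι : K →+* ℂ}

/-- **Kolyvagin's minimal-depth descent data OF A DATUM.** `E/ℚ` globally minimal without CM, `K`
imaginary quadratic with `d_K ∉ {−3, −4}` and the Heegner hypothesis for `N_E`, `c` its complex
conjugation, `p` odd with `ρ̄_{E,p^n}` onto for all `n`, a frame `(Dt, β, ι)`; granted the five named
facts (Gross Prop. 5.4 (2); McCallum Lemma 4.3, Prop. 4.4, Lemma 5.3, Prop. 2.2): for ONE datum `d₁`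
at a square-free product `n₁` of Kolyvagin primes there is a `HypothesesDepth` on `H¹(K, E[p^1])` with
`Sel = Sel(E/K)_p`, `p`, `τ = conjAct W c`, `Kol = Zhang2014.IsKolyvaginPrime N_E W K p` and
`c n₁ = d₁.kolyvaginClass hp 1` (the classes are those of the compatible system through `d₁`,
`exists_kolyvaginHeegnerSystem_extending`). CONDITIONAL on the five facts; BSD is not proved by it.
[cite: GrossLMS1991, §10 with Props. 5.4, 6.2, 8.1, 8.2] [cite: McCallumLMS1991, §§2–5] -/
theorem exists_hypothesesDepth_of_datum
    (h54 : sign_conjAct_kolyvaginClass) (h43 : lemma43_kolyvaginClass_mem_selmerLocalKer)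
    (h44 : prop44_localOrder_kolyvaginClass_mul_eq) (h53 : lemma53_selmer_eigen_dependent_at)
    (h22 : prop22_reciprocity_eigen_finset)
    (hcm : ¬ W.HasCM) (hK : IsImaginaryQuadratic K) (hD3 : NumberField.discr K ≠ -3)
    (hD4 : NumberField.discr K ≠ -4) (hH : SatisfiesHeegnerHypothesis (W.conductorNorm ℤ) K)
    (p : ℕ) [hp : Fact p.Prime] (hp2 : p ≠ 2)
    (htower : ∀ n : ℕ, W.HasSurjectiveModNGaloisRep (p ^ n : ℕ))
    (c : K ≃ₐ[ℚ] K) (hc : c ≠ 1) (hcc : c * c = 1)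
    {n₁ : ℕ} (hn₁ : Squarefree n₁)
    (hk₁ : ∀ q ∈ n₁.primeFactors, Zhang2014.IsKolyvaginPrime (W.conductorNorm ℤ) W K p q)
    (d₁ : KolyvaginHeegnerData Dt β ι n₁) :
    ∃ S : HypothesesDepth (galH1Torsion (W.baseChange K) ((p ^ 1 : ℕ) : ℤ))
        (HeightOneSpectrum (𝓞 K) ⊕ InfinitePlace K),
      S.Sel = selmerGroup (W.baseChange K) ((p ^ 1 : ℕ) : ℤ) ∧ S.p = p ∧
        S.Kol = Zhang2014.IsKolyvaginPrime (W.conductorNorm ℤ) W K p ∧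
        S.τ = conjAct W c ((p ^ 1 : ℕ) : ℤ) ∧ S.c n₁ = d₁.kolyvaginClass hp.out 1 := by
  -- `ℓ' ∈ S₁(1)` for every Kolyvagin prime (Zhang's `0 < M(ℓ')`), and Kolyvagin primes are inert
  have hS1 : ∀ {n : ℕ}, (∀ q ∈ n.primeFactors, Zhang2014.IsKolyvaginPrime (W.conductorNorm ℤ) W K p q) →
      ∀ q ∈ n.primeFactors, Zhang2014.IsKolyvaginPrime (W.conductorNorm ℤ) W K p q ∧
        1 ≤ Zhang2014.kolyvaginIndex W p q :=
    fun h q hq ↦ ⟨h q hq, (h q hq).2.2.2.2.2⟩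
  have hinert : ∀ {n : ℕ},
      (∀ q ∈ n.primeFactors, Zhang2014.IsKolyvaginPrime (W.conductorNorm ℤ) W K p q) →
      ∀ q ∈ n.primeFactors, (Ideal.span {(q : 𝓞 K)}).IsPrime :=
    fun h q hq ↦ (h q hq).2.2.2.2.1
  have hd4 : NumberField.discr K < -4 := discr_lt_neg_four_of_frame hK hD3 hD4 d₁.dvd_sq_sub
  -- the compatible system through `d₁`
  obtain ⟨d, hd₁, hcoh⟩ :=
    exists_kolyvaginHeegnerSystem_extending hK hd4 hH Dt β ι hn₁ (hinert hk₁) d₁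
  -- its class family (junk `0` off the good levels)
  let cl : ℕ → galH1Torsion (W.baseChange K) ((p ^ 1 : ℕ) : ℤ) := fun n ↦
    if h : Squarefree n ∧ ∀ q ∈ n.primeFactors, (Ideal.span {(q : 𝓞 K)}).IsPrime then
      (d n h.1 h.2).kolyvaginClass hp.out 1 else 0
  have hcl : ∀ (n : ℕ) (hn : Squarefree n)
      (hin : ∀ q ∈ n.primeFactors, (Ideal.span {(q : 𝓞 K)}).IsPrime),
      cl n = (d n hn hin).kolyvaginClass hp.out 1 := fun n hn hin ↦ by
    simp only [cl, dif_pos (show Squarefree n ∧ _ from ⟨hn, hin⟩)]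
  -- the sign law (Gross Prop. 5.4 (2))
  obtain ⟨ε, hε, hsign⟩ := h54 W hcm K hK hD3 hD4 hH p hp2 htower c hc Dt β ι 1 le_rfl
  -- `h44`: McCallum Prop. 4.4 "in particular" for the compatible pairs `(d m, d (m l))`
  have hh44 : ∀ (l m : ℕ), Squarefree (l * m) →
      (∀ q ∈ (l * m).primeFactors, Zhang2014.IsKolyvaginPrime (W.conductorNorm ℤ) W K p q) →
      Zhang2014.IsKolyvaginPrime (W.conductorNorm ℤ) W K p l →
      ∀ v : HeightOneSpectrum (𝓞 K), (l : 𝓞 K) ∈ v.asIdeal →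
        (cl (l * m) ∈ selmerLocalKer (W.baseChange K) (v.adicCompletion K) ((p ^ 1 : ℕ) : ℤ) ↔
          cl m ∈ (W.baseChange K).torsionLocalKer (v.adicCompletion K) ((p ^ 1 : ℕ) : ℤ)) := by
    intro l m hsq hk hl v hv
    have hsq' : Squarefree (m * l) := by rwa [Nat.mul_comm] at hsq
    have hk' : ∀ q ∈ (m * l).primeFactors, Zhang2014.IsKolyvaginPrime (W.conductorNorm ℤ) W K p q ∧
        1 ≤ Zhang2014.kolyvaginIndex W p q := by
      rw [Nat.mul_comm]
      exact hS1 hk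
    have hkml : ∀ q ∈ (m * l).primeFactors, Zhang2014.IsKolyvaginPrime (W.conductorNorm ℤ) W K p q :=
      fun q hq ↦ (hk' q hq).1
    have hm : Squarefree m := hsq'.squarefree_of_dvd (dvd_mul_right m l)
    have hkm : ∀ q ∈ m.primeFactors, Zhang2014.IsKolyvaginPrime (W.conductorNorm ℤ) W K p q :=
      fun q hq ↦ hkml q (Nat.mem_primeFactors.mpr ⟨Nat.prime_of_mem_primeFactors hq,
        (Nat.dvd_of_mem_primeFactors hq).trans (dvd_mul_right m l), hsq'.ne_zero⟩)
    have hlm : ¬ l ∣ m := by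
      intro hdiv
      have hll : l * l ∣ l * m := Nat.mul_dvd_mul_left l hdiv
      exact hl.1.not_isUnit (hsq l hll)
    obtain ⟨hσ, hS₁, hS₂, hemb⟩ :=
      hcoh m (m * l) hm (hinert hkm) hsq' (hinert hkml) (dvd_mul_right m l)
    have hA := kolyvaginClass_mul_mem_selmerLocalKer_iff_of_prop44 h44 W hcm K hK hD3 hD4 hH p hp2
      htower Dt β ι 1 le_rfl m l hsq' hl.1 hlm hk' (d m hm (hinert hkm)) (d (m * l) hsq' (hinert hkml))
      hσ hS₁ hS₂ hemb v hv
    have hB := kolyvaginClass_mul_mem_torsionLocalKer_iff_of_prop44 h44 W hcm K hK hD3 hD4 hH p hp2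
      htower Dt β ι 1 le_rfl m l hsq' hl.1 hlm hk' (d m hm (hinert hkm)) (d (m * l) hsq' (hinert hkml))
      hσ hS₁ hS₂ hemb v hv
    rw [Nat.mul_comm l m, hcl (m * l) hsq' (hinert hkml), hcl m hm (hinert hkm)]
    exact hA.trans hB
  obtain ⟨S, hSel, hSp, hSc, hSK, hSτ⟩ := exists_hypothesesDepth_of_classes hcm hK p hp2 htower c hc
    hcc cl ε hε
    (fun n hn hk ↦ by rw [hcl n hn (hinert hk)]; exact hsign n hn (hS1 hk) _)
    (fun n hn hk v hv ↦ by
      rw [hcl n hn (hinert hk)]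
      exact (h43 W hcm K hK hD3 hD4 hH p hp2 htower Dt β ι 1 le_rfl n hn (hS1 hk) _).1 v hv)
    (fun n hn hk w ↦ by
      rw [hcl n hn (hinert hk)]
      exact (h43 W hcm K hK hD3 hD4 hH p hp2 htower Dt β ι 1 le_rfl n hn (hS1 hk) _).2 w)
    hh44
    (fun l hl e he s₁ hs₁ hτ₁ s₂ hs₂ hτ₂ ↦ h53 W hcm K hK p hp2 htower c hc 1 le_rfl l hl
      hl.2.2.2.2.2 e he s₁ hs₁ hτ₁ s₂ hs₂ hτ₂)
    (fun T hT l hlT e he x hx hoff hinf s hs hτs hsT v hv hsv ↦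
      mem_selmerLocalKer_of_not_mem_torsionLocalKer_of_prop22 h22 W hcm K hK p hp2 htower c hc T hT
        hlT e he x hx hoff hinf s hs hτs hsT v hv hsv)
  refine ⟨S, hSel, hSp, hSK, hSτ, ?_⟩
  rw [hSc, hcl n₁ hn₁ (hinert hk₁), hd₁]

/-- **`#Sel_p(E^{(d_K)}/ℚ) ≤ p^{ν}` OF A DATUM** (the other eigenspace, no twist point, no system): in
the setting of `exists_hypothesesDepth_of_datum`, if `d₁.kolyvaginClass hp 1 ≠ 0` and
`ν(n₁) + 1 ≤ rank E(ℚ)`, then `Sel^(p)(E^{(d_K)}/ℚ)` is finite of order `≤ p^{ν}` and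
`p^{rank E^{(d_K)}(ℚ)} · #E^{(d_K)}(ℚ)[p] · #Ш(E^{(d_K)}/ℚ)[p] ≤ p^{ν}` (g6's
`natCard_selmerGroup_twist_le_of_hypothesesDepth` at `m = p^1`). CONDITIONAL on the five named facts;
per-curve; BSD is not proved by it. [cite: Kolyvagin1991MathAnn, Thm. 2.3]
[cite: GrossLMS1991, §5 (5.1) and §10] -/
theorem natCard_selmerGroup_twist_le_of_kolyvaginClass_ne_zero_of_datum
    (h54 : sign_conjAct_kolyvaginClass) (h43 : lemma43_kolyvaginClass_mem_selmerLocalKer)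
    (h44 : prop44_localOrder_kolyvaginClass_mul_eq) (h53 : lemma53_selmer_eigen_dependent_at)
    (h22 : prop22_reciprocity_eigen_finset)
    (hcm : ¬ W.HasCM) (hK : IsImaginaryQuadratic K) (hD3 : NumberField.discr K ≠ -3)
    (hD4 : NumberField.discr K ≠ -4) (hH : SatisfiesHeegnerHypothesis (W.conductorNorm ℤ) K)
    (p : ℕ) [hp : Fact p.Prime] (hp2 : p ≠ 2)
    (htower : ∀ n : ℕ, W.HasSurjectiveModNGaloisRep (p ^ n : ℕ))
    (c : K ≃ₐ[ℚ] K) (hc : c ≠ 1) (hcc : c * c = 1)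
    {n₁ : ℕ} (hn₁ : Squarefree n₁)
    (hk₁ : ∀ q ∈ n₁.primeFactors, Zhang2014.IsKolyvaginPrime (W.conductorNorm ℤ) W K p q)
    (d₁ : KolyvaginHeegnerData Dt β ι n₁) (hne : d₁.kolyvaginClass hp.out 1 ≠ 0)
    (hrank : n₁.primeFactors.card + 1 ≤ W.mordellWeilRank) :
    Finite ↥(selmerGroup (W.quadraticTwist (NumberField.discr K : ℚ)) ((p ^ 1 : ℕ) : ℤ)) ∧
      Nat.card ↥(selmerGroup (W.quadraticTwist (NumberField.discr K : ℚ)) ((p ^ 1 : ℕ) : ℤ)) ≤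
        p ^ n₁.primeFactors.card ∧
      p ^ (W.quadraticTwist (NumberField.discr K : ℚ)).mordellWeilRank *
          Nat.card ↥(AddSubgroup.torsionBy (W.quadraticTwist (NumberField.discr K : ℚ)).toAffine.Point
            ((p ^ 1 : ℕ) : ℤ)) *
          Nat.card ↥((W.quadraticTwist (NumberField.discr K : ℚ)).sha ⊓
            AddSubgroup.torsionBy (W.quadraticTwist (NumberField.discr K : ℚ)).galH1
              ((p ^ 1 : ℕ) : ℤ)) ≤ p ^ n₁.primeFactors.card := by
  obtain ⟨S, hSel, hSp, hSK, hSτ, hSc⟩ := exists_hypothesesDepth_of_datum h54 h43 h44 h53 h22 hcm hK hD3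
    hD4 hH p hp2 htower c hc hcc hn₁ hk₁ d₁
  have hsupp : KolSupp S.Kol n₁ := by rw [hSK]; exact ⟨hn₁, hk₁⟩
  have hne' : S.c n₁ ≠ 0 := by rw [hSc]; exact hne
  exact natCard_selmerGroup_twist_le_of_hypothesesDepth W K hK.1 c hc p hp2 (pow_one p) S hSel hSp hSτ
    hsupp hne' hrank

end Datum

end Summit.BirchSwinnertonDyer.BirchSwinnertonDyer.Theorems.KolyvaginDepthDoor

end
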